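import Summits.NavierStokesRegularity.NavierStokesRegularity.Theorems.TerminalTraceTypeITraceScarL3ExteriorHarmonicTools
import HarnessLib

/-!
# The slice estimate for C2 of the vorticity cut of Stub C
# (item `TerminalTrace.TypeITraceScarL3`, stmt-NavierStokesRegularity-18385, seed s25-6)

Seat ns-typeII-p3 g9 (cell ns-regularity-ideate), `--supports stmt-NavierStokesRegularity-18385` (helper).
One slice of the C2 argument («exterior-irrotational ⇒ confined», file
`TerminalTraceTypeITraceScarL3ExteriorIrrotationalConfined.lean`):

* `norm_le_of_irrotational_exterior_slice` — a field `W : ℝ³ → ℝ³`, `C²` with `curl W = 0`, `div W = 0`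
  on `(closedBall 0 R)ᶜ`, agreeing a.e. there with a field `u` whose ball energies satisfy
  `∫_{B(0,ρ)} |u|² ≤ M ρ` at the radii `ρ = n + n₀` (`n : ℕ`, `n₀ ≥ 1`), obeys
  `‖W(x)‖ ≤ C (c₁/(4R²) + 3M + M(n₀+1)/(2R))` for `‖x‖ > 4R` (`C` the interior mean value constant,
  `c₁ = |B(0,1)|`): each coordinate is harmonic on `B(x, ‖x‖/2)`
  (`laplacian_eq_zero_of_eventually_curl_eq_zero_of_divergence_eq_zero`), the interior mean value
  bound (`exists_const_abs_le_integral_ball_of_harmonicOn`) and `2|v| ≤ λ + v²/λ` with `λ = r⁻²` turn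
  `r⁻³ ∫_{B(x,r)} |Wᵢ|` into `½ C (c₁ r⁻² + r⁻¹ M ρ)`, `ρ ≤ 3r + n₀ + 1`, bounded for `r ≥ 2R`;
* the helper `two_mul_abs_le_add_sq_div`.

WHAT THIS IS NOT: not Stub C, not NS — harmonic-function bookkeeping for C2.
[folklore; GilbargTrudinger2001 Thm 2.1; KNSS2009 Lemma 3.1]
-/

noncomputable section

set_option linter.dupNamespace false

namespace Summit.NavierStokesRegularity.NavierStokesRegularity.Theorems.TypeITraceScarL3

open MeasureTheory Set Function Filter Topology Metric InnerProductSpace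
open Literature.Analysis.FluidPDE
open scoped NNReal ENNReal RealInnerProductSpace Laplacian ContDiff

/-! ### The slice estimate -/

/-- The elementary inequality `2|v| ≤ λ + v²/λ` (`λ > 0`). [folklore] -/
theorem two_mul_abs_le_add_sq_div {v lam : ℝ} (hlam : 0 < lam) : 2 * |v| ≤ lam + v ^ 2 / lam := by
  rw [← sq_abs]
  have h : 0 ≤ (lam - |v|) ^ 2 / lam := by positivity
  have h' : (lam - |v|) ^ 2 / lam = lam + |v| ^ 2 / lam - 2 * |v| := by
    field_simp
    ring
  linarith [h, h']

/-- **The slice estimate.**  Let `C` be a constant of the interior mean value bound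
(`exists_const_abs_le_integral_ball_of_harmonicOn`), `c₁ = |B(0,1)|`.  Let `W : ℝ³ → ℝ³` be `C²` on
`(closedBall 0 R)ᶜ` with `curl W = 0`, `div W = 0` there, and let `W = u` a.e. on `(closedBall 0 R)ᶜ`
for a field `u` with `∫_{B(0, n + n₀)} |u|² ≤ M (n + n₀)` for every `n : ℕ` (`n₀ ≥ 1`).  Then for
`‖x‖ > 4R`: `‖W(x)‖ ≤ C (c₁/(4R²) + 3M + M(n₀ + 1)/(2R))`.  Proof: with `r = ‖x‖/2 > 2R` the ball
`B(x, r)` lies in the exterior region and in `B(0, ρ)`, `ρ = ⌈3r⌉₊ + n₀ ≤ 3r + n₀ + 1`; each coordinate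
`Wᵢ` is harmonic on `B(x, r)`, so `|Wᵢ(x)| ≤ C r⁻³ ∫_{B(x,r)} |Wᵢ| ≤ C r⁻³ · ½(r⁻² c₁ r³ + r² M ρ)`.
[folklore; GilbargTrudinger2001 Thm 2.1] -/
theorem norm_le_of_irrotational_exterior_slice
    {C : ℝ} (hC0 : 0 ≤ C)
    (hC : ∀ (h : EuclideanSpace ℝ (Fin 3) → ℝ) (x : EuclideanSpace ℝ (Fin 3)) (r : ℝ),
      0 < r → ContDiffOn ℝ 2 h (ball x r) → (∀ w ∈ ball x r, (Δ h) w = 0) →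
      IntegrableOn h (ball x r) volume →
      |h x| ≤ C * (r ^ 3)⁻¹ * ∫ y in ball x r, |h y|)
    {W u : EuclideanSpace ℝ (Fin 3) → EuclideanSpace ℝ (Fin 3)} {R : ℝ} (hR : 0 < R)
    (hW : ContDiffOn ℝ 2 W (closedBall (0 : EuclideanSpace ℝ (Fin 3)) R)ᶜ)
    (hcd : ∀ x ∈ (closedBall (0 : EuclideanSpace ℝ (Fin 3)) R)ᶜ,
      curl W x = 0 ∧ VectorCalculus.divergence W x = 0)
    (hWu : ∀ᵐ y ∂(volume.restrict (closedBall (0 : EuclideanSpace ℝ (Fin 3)) R)ᶜ), W y = u y)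
    {M : ℝ≥0} {n₀ : ℕ} (hn₀ : 1 ≤ n₀)
    (hA : ∀ n : ℕ, ∫⁻ y in ball (0 : EuclideanSpace ℝ (Fin 3)) ((n : ℝ) + n₀), ‖u y‖ₑ ^ 2 ≤
      (M : ℝ≥0∞) * ENNReal.ofReal ((n : ℝ) + n₀))
    {x : EuclideanSpace ℝ (Fin 3)} (hx : 4 * R < ‖x‖) :
    ‖W x‖ ≤ C * ((volume (ball (0 : EuclideanSpace ℝ (Fin 3)) 1)).toReal / (4 * R ^ 2) + 3 * M +
      M * (n₀ + 1) / (2 * R)) := by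
  -- ### geometry
  set c₁ : ℝ := (volume (ball (0 : EuclideanSpace ℝ (Fin 3)) 1)).toReal with hc₁
  have hc₁0 : 0 ≤ c₁ := ENNReal.toReal_nonneg
  set S : Set (EuclideanSpace ℝ (Fin 3)) := (closedBall (0 : EuclideanSpace ℝ (Fin 3)) R)ᶜ with hSdef
  have hSo : IsOpen S := isClosed_closedBall.isOpen_compl
  set r : ℝ := ‖x‖ / 2 with hrdef
  have hr2R : 2 * R < r := by rw [hrdef]; linarith
  have hr : 0 < r := by linarith
  have hcBS : closedBall x r ⊆ S := by
    intro y hy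
    rw [hSdef, mem_compl_iff, mem_closedBall_zero_iff, not_le]
    rw [mem_closedBall, dist_eq_norm] at hy
    have h1 : ‖x‖ - ‖y‖ ≤ ‖y - x‖ := by
      rw [← norm_neg (y - x), neg_sub]; exact norm_sub_norm_le x y
    linarith
  have hBS : ball x r ⊆ S := ball_subset_closedBall.trans hcBS
  -- the radius `ρ = ⌈3r⌉₊ + n₀` of the `A`-ball
  set n : ℕ := ⌈3 * r⌉₊ with hndef
  have hn3r : 3 * r ≤ (n : ℝ) := Nat.le_ceil _
  have hnle : (n : ℝ) ≤ 3 * r + 1 := (Nat.ceil_lt_add_one (by positivity)).le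
  set ρ : ℝ := (n : ℝ) + n₀ with hρdef
  have hn₀' : (1 : ℝ) ≤ n₀ := by exact_mod_cast hn₀
  have hρpos : 0 < ρ := by positivity
  have hρle : ρ ≤ 3 * r + n₀ + 1 := by rw [hρdef]; linarith
  have hB0 : ball x r ⊆ ball (0 : EuclideanSpace ℝ (Fin 3)) ρ := by
    intro y hy
    rw [mem_ball, dist_eq_norm] at hy
    rw [mem_ball_zero_iff]
    have h1 : ‖y‖ ≤ ‖y - x‖ + ‖x‖ := by
      have := norm_add_le (y - x) x; rwa [sub_add_cancel] at this
    have h2 : ‖x‖ = 2 * r := by rw [hrdef]; ring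
    linarith
  -- ### `W` is `C²` at the points of `S`, harmonic there
  have hΔW : ∀ w ∈ S, (Δ W) w = 0 := fun w hw =>
    laplacian_eq_zero_of_eventually_curl_eq_zero_of_divergence_eq_zero
      (hW.contDiffAt (hSo.mem_nhds hw))
      (Filter.eventually_of_mem (hSo.mem_nhds hw) fun y hy => (hcd y hy).1)
      (Filter.eventually_of_mem (hSo.mem_nhds hw) fun y hy => (hcd y hy).2)
  -- ### the energy of `W` on `B(x, r)`: `∫_{B(x,r)} ‖W‖² ≤ M ρ`
  have hWc : ContinuousOn W (closedBall x r) := hW.continuousOn.mono hcBS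
  have hWint : IntegrableOn (fun y => ‖W y‖ ^ 2) (ball x r) volume := by
    have h := ContinuousOn.integrableOn_compact (μ := volume) (isCompact_closedBall x r)
      (hWc.norm.pow 2)
    exact h.mono_set ball_subset_closedBall
  have henergy : ∫ y in ball x r, ‖W y‖ ^ 2 ≤ (M : ℝ) * ρ := by
    have h1 : ∫⁻ y in ball x r, ‖W y‖ₑ ^ 2 = ∫⁻ y in ball x r, ‖u y‖ₑ ^ 2 := by
      refine lintegral_congr_ae ?_
      filter_upwards [ae_restrict_of_ae_restrict_of_subset hBS hWu] with y hy
      rw [hy]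
    have h2 : ∫⁻ y in ball x r, ‖W y‖ₑ ^ 2 ≤ (M : ℝ≥0∞) * ENNReal.ofReal ρ := by
      rw [h1]; exact (lintegral_mono_set hB0).trans (hA n)
    have h3 : ∫ y in ball x r, ‖W y‖ ^ 2 = (∫⁻ y in ball x r, ‖W y‖ₑ ^ 2).toReal := by
      rw [integral_eq_lintegral_of_nonneg_ae (Eventually.of_forall fun y => by positivity)
        hWint.aestronglyMeasurable]
      congr 1
      refine lintegral_congr_ae (Eventually.of_forall fun y => ?_)
      show ENNReal.ofReal (‖W y‖ ^ 2) = ‖W y‖ₑ ^ 2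
      rw [ENNReal.ofReal_pow (norm_nonneg _), ofReal_norm]
    rw [h3]
    have h4 : ((M : ℝ≥0∞) * ENNReal.ofReal ρ).toReal = (M : ℝ) * ρ := by
      rw [ENNReal.toReal_mul, ENNReal.toReal_ofReal hρpos.le, ENNReal.coe_toReal]
    rw [← h4]
    exact ENNReal.toReal_mono (ENNReal.mul_ne_top ENNReal.coe_ne_top ENNReal.ofReal_ne_top) h2
  -- ### the volume of `B(x, r)`
  have hvol : (volume (ball x r)).toReal = r ^ 3 * c₁ := by
    rw [Measure.addHaar_ball volume x hr.le, finrank_euclideanSpace_fin, ENNReal.toReal_mul,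
      ENNReal.toReal_ofReal (by positivity), hc₁]
  -- ### each coordinate
  set lam : ℝ := (r ^ 2)⁻¹ with hlamdef
  have hlam : 0 < lam := by positivity
  set K₀ : ℝ := C / 2 * (c₁ / (4 * R ^ 2) + 3 * M + M * (n₀ + 1) / (2 * R)) with hK₀def
  have hK₀0 : 0 ≤ K₀ := by positivity
  have hcoord : ∀ i : Fin 3, |W x i| ≤ K₀ := by
    intro i
    set h : EuclideanSpace ℝ (Fin 3) → ℝ := fun y => W y i with hhdef
    have hhproj : h = (EuclideanSpace.proj i : EuclideanSpace ℝ (Fin 3) →L[ℝ] ℝ) ∘ W := by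
      funext y; rfl
    -- `h` is `C²` and harmonic on `B(x, r)`, integrable there
    have hh2 : ContDiffOn ℝ 2 h (ball x r) := by
      rw [hhproj]
      exact (EuclideanSpace.proj i : EuclideanSpace ℝ (Fin 3) →L[ℝ] ℝ).contDiff.comp_contDiffOn
        (hW.mono hBS)
    have hhΔ : ∀ w ∈ ball x r, (Δ h) w = 0 := by
      intro w hw
      have hWw : ContDiffAt ℝ 2 W w := hW.contDiffAt (hSo.mem_nhds (hBS hw))
      rw [hhproj, hWw.laplacian_CLM_comp_left]
      simp [hΔW w (hBS hw)]
    have hhc : ContinuousOn h (closedBall x r) := by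
      rw [hhproj]
      exact (EuclideanSpace.proj i : EuclideanSpace ℝ (Fin 3) →L[ℝ] ℝ).continuous.comp_continuousOn hWc
    have hhint : IntegrableOn h (ball x r) volume :=
      (ContinuousOn.integrableOn_compact (μ := volume) (isCompact_closedBall x r) hhc).mono_set
        ball_subset_closedBall
    -- the mean value bound
    have hmv := hC h x r hr hh2 hhΔ hhint
    -- `∫_{B(x,r)} |h| ≤ ½ (λ |B| + λ⁻¹ ∫ ‖W‖²)`
    have hsqint : IntegrableOn (fun y => h y ^ 2) (ball x r) volume := by
      have hc2 : ContinuousOn (fun y => h y ^ 2) (closedBall x r) := hhc.pow 2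
      exact (ContinuousOn.integrableOn_compact (μ := volume) (isCompact_closedBall x r) hc2).mono_set
        ball_subset_closedBall
    have hL1 : ∫ y in ball x r, |h y| ≤ (lam * (r ^ 3 * c₁) + lam⁻¹ * ((M : ℝ) * ρ)) / 2 := by
      have hpt : ∀ y, |h y| ≤ (lam + h y ^ 2 / lam) / 2 := fun y => by
        have := two_mul_abs_le_add_sq_div (v := h y) hlam
        linarith
      have hconst : IntegrableOn (fun _ => lam) (ball x r) volume :=
        integrableOn_const (hs := measure_ball_lt_top.ne)
      have hrhs : IntegrableOn (fun y => (lam + h y ^ 2 / lam) / 2) (ball x r) volume :=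
        (hconst.add (hsqint.div_const lam)).div_const 2
      calc ∫ y in ball x r, |h y| ≤ ∫ y in ball x r, (lam + h y ^ 2 / lam) / 2 :=
            setIntegral_mono hhint.abs hrhs hpt
        _ = ((volume (ball x r)).toReal * lam + (∫ y in ball x r, h y ^ 2) / lam) / 2 := by
            rw [integral_div, integral_add hconst (hsqint.div_const lam), integral_div,
              setIntegral_const, smul_eq_mul]
            rfl
        _ ≤ (lam * (r ^ 3 * c₁) + lam⁻¹ * ((M : ℝ) * ρ)) / 2 := by
            rw [hvol]
            have hsq_le : ∫ y in ball x r, h y ^ 2 ≤ (M : ℝ) * ρ := by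
              refine le_trans (setIntegral_mono_on hsqint hWint measurableSet_ball fun y _ => ?_) henergy
              have : |W y i| ≤ ‖W y‖ := by
                rw [← Real.norm_eq_abs]; exact PiLp.norm_apply_le (W y) i
              show (W y i) ^ 2 ≤ ‖W y‖ ^ 2
              rw [← sq_abs]
              exact pow_le_pow_left₀ (abs_nonneg _) this 2
            have : (∫ y in ball x r, h y ^ 2) / lam ≤ lam⁻¹ * ((M : ℝ) * ρ) := by
              rw [div_eq_inv_mul]
              exact mul_le_mul_of_nonneg_left hsq_le (inv_nonneg.2 hlam.le)
            nlinarith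
    -- assemble: `|h x| ≤ C r⁻³ · ½ (r⁻² r³ c₁ + r² M ρ) = ½ C (c₁/r² + M ρ / r)`
    have hstep : |h x| ≤ C / 2 * (c₁ / r ^ 2 + (M : ℝ) * ρ / r) := by
      have h1 := hmv.trans (mul_le_mul_of_nonneg_left hL1 (by positivity))
      have h2 : C * (r ^ 3)⁻¹ * ((lam * (r ^ 3 * c₁) + lam⁻¹ * ((M : ℝ) * ρ)) / 2) =
          C / 2 * (c₁ / r ^ 2 + (M : ℝ) * ρ / r) := by
        rw [hlamdef]
        field_simp
      rw [h2] at h1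
      exact h1
    -- monotonicity in `r ≥ 2R`, `ρ ≤ 3r + n₀ + 1`
    have hb1 : c₁ / r ^ 2 ≤ c₁ / (4 * R ^ 2) := by
      refine div_le_div_of_nonneg_left hc₁0 (by positivity) ?_
      nlinarith
    have hb2 : (M : ℝ) * ρ / r ≤ 3 * M + M * (n₀ + 1) / (2 * R) := by
      have hM0 : (0 : ℝ) ≤ M := M.coe_nonneg
      have h1 : (M : ℝ) * ρ / r ≤ (M : ℝ) * (3 * r + n₀ + 1) / r :=
        div_le_div_of_nonneg_right (mul_le_mul_of_nonneg_left hρle hM0) hr.le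
      have h2 : (M : ℝ) * (3 * r + n₀ + 1) / r = 3 * M + M * (n₀ + 1) / r := by
        field_simp
        ring
      have h3 : (M : ℝ) * (n₀ + 1) / r ≤ M * (n₀ + 1) / (2 * R) :=
        div_le_div_of_nonneg_left (by positivity) (by positivity) hr2R.le
      linarith
    calc |h x| ≤ C / 2 * (c₁ / r ^ 2 + (M : ℝ) * ρ / r) := hstep
      _ ≤ C / 2 * (c₁ / (4 * R ^ 2) + (3 * M + M * (n₀ + 1) / (2 * R))) :=
          mul_le_mul_of_nonneg_left (add_le_add hb1 hb2) (by positivity)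
      _ = K₀ := by rw [hK₀def]; ring
  -- ### the norm: `‖W x‖² = Σ |Wᵢ(x)|² ≤ 3K₀² ≤ (2K₀)²`
  have hnorm : ‖W x‖ ≤ 2 * K₀ := by
    have hc : ∀ i : Fin 3, ‖W x i‖ ^ 2 ≤ K₀ ^ 2 := fun i => by
      rw [Real.norm_eq_abs]
      exact pow_le_pow_left₀ (abs_nonneg _) (hcoord i) 2
    rw [EuclideanSpace.norm_eq, Real.sqrt_le_iff]
    refine ⟨by positivity, ?_⟩
    calc ∑ i, ‖W x i‖ ^ 2 ≤ ∑ _i : Fin 3, K₀ ^ 2 := Finset.sum_le_sum fun i _ => hc i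
      _ = 3 * K₀ ^ 2 := by simp
      _ ≤ (2 * K₀) ^ 2 := by nlinarith
  calc ‖W x‖ ≤ 2 * K₀ := hnorm
    _ = C * (c₁ / (4 * R ^ 2) + 3 * M + M * (n₀ + 1) / (2 * R)) := by rw [hK₀def]; ring

end Summit.NavierStokesRegularity.NavierStokesRegularity.Theorems.TypeITraceScarL3

end
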